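import Literature.NumberTheory.ComplexMultiplication.EllipticUnits.ImaginaryQuadraticMainConjectureCarriersOLevels
import Literature.NumberTheory.ComplexMultiplication.EllipticUnits.ImaginaryQuadraticMainConjectureCarriersGroupElt
import HarnessLib

/-!
# The group elements `σ = γ₁^{x₁}γ₂^{x₂} ↦ (1+T₁)^{x₁}(1+T₂)^{x₂} ∈ Λ_𝒪 = 𝒪⟦T₂⟧⟦T₁⟧` act on EVERY pinned `𝒪`-carrier
# `H^i(𝒪_K[1/p𝔣], Λ_𝒪(χ)(1))` (Johnson-Leung–Kings 2011 Def. 4.2 (94)) levelwise as conjugation by `σ`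

INPUTS hand `bsd-inputs-honda-p1` g22 (prover-bsd-inputs-honda-p1-g22-0); brick 3/4 of the UNIT HALF of
`Nonempty (TwistedIwasawaDataO …)` (row D2-O-EXIST of crux L `SmallImageLowerHalfBothSigns`, stmt-BirchSwinnertonDyer-23599,
line `rtt_w3`, LEAD `cruxlead-stmt-BirchSwinnertonDyer-23599` g9). The `𝒪`-coefficient twin of the cell `bsd-print-cf2` file
`…CarriersGroupElt` (route C, `ℤ_p`): the bridge between the (A1) Artin pin `artin_spec` of `TwistedIwasawaDataO` and the
`Λ_𝒪`-module structure (P5)–(P8) of an ARBITRARY pinned datum `IwasawaCohomologyDataO`. Theorems only; no definition, no named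
fact, no `instance`, no `sorry`; nothing about BSD or Cor. 5.3 is proved.

THE STATEMENT (§4.2 "the (left) `Λ_𝒪`-module structure", §5.1 "`σ_𝔞 ∈ Gal(K_∞/K) ⊂ Λ`"): for every pinned `𝒪`-datum `I`
(`i ≤ 2`), `x ∈ H^i`, `p`-adic exponents `x₁, x₂`: the level-`(n,k)` component of `groupEltO S x₁ x₂ • x` is
`conj_{γ₁}^{x₁ mod pⁿ} conj_{γ₂}^{x₂ mod pⁿ}` of the component (**`proj_groupEltO_smul`**), hence `conj_g` of it for EVERY
`g ∈ Γ_K` with `γ₁^{m₁}γ₂^{m₂}g⁻¹ ∈ Gal(K̄/K̃_n)` (**`proj_groupEltO_smul_eq_layerConjO`**) — the shape of (A1) — and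
`nsubEltO 𝔞 = N𝔞 − χ(σ_𝔞)⁻¹σ_𝔞` acts as `N𝔞 − χ(σ_𝔞)⁻¹ · conj_g` with the HONEST `𝒪`-scalar `χ(σ_𝔞)⁻¹ = thetaArtinO⁻¹`
through (P7) (**`proj_nsubEltO_smul`**; no `mod p^k` representative is needed over `𝒪`). For a `TwistedIwasawaDataO`:
**`TwistedIwasawaDataO.exists_proj_artin_smul`**, **`TwistedIwasawaDataO.exists_proj_nsub_smul`**.

THE PROOF: the `ℤ_p` file's binomial-series congruence `(1+T)^x ≡ (1+T)^m (mod (1+T)^{pⁿ} − 1)`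
(`exists_binomialSeries_sub_one_add_X_pow_val_eq`) pushed along the ring map `Λ → Λ_𝒪` (`iwasawaToIwasawaO₂`,
`groupEltO = iwasawaToIwasawaO₂ ∘ groupElt`); on the level `(1+T_j)^m` acts as `conj_{γ_j}^m` by (P5)/(P6),
`(1+T_j)^{pⁿ} − 1` as `conj_{γ_j^{pⁿ}} − 1 = 0` (`layerConjEndO_pow_apply_eq_self`, `i ≤ 2`), and its multiples as `0` by (P8).

References: [JohnsonLeungKings2011] §4.1 Def. 4.1, §4.2 (arXiv p0012:L39–60, L80–112), §5.1 (p0014:L12–26); [Lang1990] Ch. 5 §1;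
[NeukirchSchmidtWingberg2008] (5.3.5); [SerreLocalFields1979] VII §5.
-/

noncomputable section

open scoped NumberField
open CategoryTheory Field IsDedekindDomain PowerSeries
open Literature.NumberTheory.GaloisRepresentations
open Literature.NumberTheory.EllipticCurves Literature.NumberTheory.EllipticCurves.IwasawaDual

namespace Literature.NumberTheory.ComplexMultiplication.EllipticUnits.JohnsonLeungKings2011

section Datum

variable {K : Type} [Field K] [NumberField K] {p : ℕ} [Fact p.Prime] {S : Set (PadicAlgCl p)}
  {κ₁ κ₂ : ZpExtension K p} {γ₁ γ₂ : absoluteGaloisGroup K}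
  {θ : absoluteGaloisGroup K →ₜ* (padicCoeffIntegers S)ˣ} {𝔣 : Ideal (𝓞 K)} {i : ℕ}
  (I : IwasawaCohomologyDataO S κ₁ κ₂ γ₁ γ₂ θ 𝔣 i)

namespace IwasawaCohomologyDataO

/-- **`(1+T₁)^j` acts on the level `(n,k)` as `conj_{γ₁}^j`** ((P5) iterated). [cite: JohnsonLeungKings2011, §4.2 (arXiv p0012:L109–112)] -/
theorem proj_one_add_X_pow_smul (j n k : ℕ) (x : I.H) :
    I.proj n k ((1 + PowerSeries.X : IwasawaAlgebraO₂ S) ^ j • x) =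
      (layerConjEndO S κ₁ κ₂ θ 𝔣 n k i γ₁ ^ j) (I.proj n k x) := by
  induction j generalizing x with
  | zero => rw [pow_zero, one_smul, pow_zero, AddMonoid.End.one_apply]
  | succ j ih =>
    rw [pow_succ, mul_smul, ih, pow_succ, AddMonoid.End.coe_mul, Function.comp_apply, add_smul, one_smul,
      map_add, I.proj_T₁_smul, add_sub_cancel]
    rfl

/-- **`(1+T₂)^j` acts on the level `(n,k)` as `conj_{γ₂}^j`** ((P6) iterated). [cite: JohnsonLeungKings2011, §4.2 (arXiv p0012:L109–112)] -/
theorem proj_one_add_CX_pow_smul (j n k : ℕ) (x : I.H) :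
    I.proj n k ((1 + PowerSeries.C (PowerSeries.X : PowerSeries (padicCoeffIntegers S)) : IwasawaAlgebraO₂ S) ^ j • x) =
      (layerConjEndO S κ₁ κ₂ θ 𝔣 n k i γ₂ ^ j) (I.proj n k x) := by
  induction j generalizing x with
  | zero => rw [pow_zero, one_smul, pow_zero, AddMonoid.End.one_apply]
  | succ j ih =>
    rw [pow_succ, mul_smul, ih, pow_succ, AddMonoid.End.coe_mul, Function.comp_apply, add_smul, one_smul,
      map_add, I.proj_T₂_smul, add_sub_cancel]
    rfl

/-- **`(1+T₁)^{pⁿ} − 1` kills the level `(n,k)`**, `i ≤ 2` (it acts as `conj_{γ₁^{pⁿ}} − 1`, `γ₁^{pⁿ} ∈ Gal(K̄/K̃_n)`).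
[cite: Lang1990, Ch. 5 §1] [cite: JohnsonLeungKings2011, §4.2 (arXiv p0012:L109–112)] -/
theorem proj_one_add_X_pow_sub_one_smul (hi : i ≤ 2) (n k : ℕ) (x : I.H) :
    I.proj n k (((1 + PowerSeries.X : IwasawaAlgebraO₂ S) ^ (p ^ n) - 1) • x) = 0 := by
  rw [sub_smul, one_smul, map_sub, proj_one_add_X_pow_smul, layerConjEndO_pow_apply_eq_self S κ₁ κ₂ θ 𝔣 n k hi,
    sub_self]

/-- **`(1+T₂)^{pⁿ} − 1` kills the level `(n,k)`**, `i ≤ 2`. [cite: Lang1990, Ch. 5 §1] [cite: JohnsonLeungKings2011, §4.2 (arXiv p0012:L109–112)] -/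
theorem proj_one_add_CX_pow_sub_one_smul (hi : i ≤ 2) (n k : ℕ) (x : I.H) :
    I.proj n k (((1 + PowerSeries.C (PowerSeries.X : PowerSeries (padicCoeffIntegers S)) : IwasawaAlgebraO₂ S) ^ (p ^ n) - 1) •
      x) = 0 := by
  rw [sub_smul, one_smul, map_sub, proj_one_add_CX_pow_smul, layerConjEndO_pow_apply_eq_self S κ₁ κ₂ θ 𝔣 n k hi,
    sub_self]

/-- **`(1+T₁)^{x₁}` (read in `Λ_𝒪`) acts on the level `(n,k)` as `conj_{γ₁}^{x₁ mod pⁿ}`**, `i ≤ 2`, for every `p`-adic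
exponent `x₁`. [cite: JohnsonLeungKings2011, §4.2 (arXiv p0012:L109–112)] [cite: Lang1990, Ch. 5 §1] -/
theorem proj_map_binomialSeries_smul (hi : i ≤ 2) (x₁ : ℤ_[p]) (n k : ℕ) (x : I.H) :
    I.proj n k (iwasawaToIwasawaO₂ S (PowerSeries.map PowerSeries.C (binomialSeries ℤ_[p] x₁)) • x) =
      (layerConjEndO S κ₁ κ₂ θ 𝔣 n k i γ₁ ^ (PadicInt.toZModPow n x₁).val) (I.proj n k x) := by
  obtain ⟨q, hq⟩ := exists_binomialSeries_sub_one_add_X_pow_val_eq n x₁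
  rw [sub_eq_iff_eq_add'] at hq
  have hX : iwasawaToIwasawaO₂ S (X : IwasawaAlgebra₂ p) = (X : IwasawaAlgebraO₂ S) := by
    rw [iwasawaToIwasawaO₂, PowerSeries.map_X]
  rw [hq]
  simp only [map_add, map_mul, map_pow, map_sub, map_one, PowerSeries.map_X, hX]
  rw [add_smul, map_add, proj_one_add_X_pow_smul, mul_comm, mul_smul,
    I.proj_smul_eq_zero n k _ _ (I.proj_one_add_X_pow_sub_one_smul hi n k x), add_zero]

/-- **`(1+T₂)^{x₂}` (read in `Λ_𝒪`) acts on the level `(n,k)` as `conj_{γ₂}^{x₂ mod pⁿ}`**, `i ≤ 2`.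
[cite: JohnsonLeungKings2011, §4.2 (arXiv p0012:L109–112)] [cite: Lang1990, Ch. 5 §1] -/
theorem proj_C_binomialSeries_smul (hi : i ≤ 2) (x₂ : ℤ_[p]) (n k : ℕ) (x : I.H) :
    I.proj n k (iwasawaToIwasawaO₂ S (PowerSeries.C (binomialSeries ℤ_[p] x₂)) • x) =
      (layerConjEndO S κ₁ κ₂ θ 𝔣 n k i γ₂ ^ (PadicInt.toZModPow n x₂).val) (I.proj n k x) := by
  obtain ⟨q, hq⟩ := exists_binomialSeries_sub_one_add_X_pow_val_eq n x₂
  rw [sub_eq_iff_eq_add'] at hq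
  have hC : ∀ g : PowerSeries ℤ_[p], iwasawaToIwasawaO₂ S (PowerSeries.C g) =
      PowerSeries.C (PowerSeries.map (padicIntToCoeffIntegers S) g) := fun g ↦ by
    rw [iwasawaToIwasawaO₂, PowerSeries.map_C]
  rw [hq, hC]
  simp only [map_add, map_mul, map_pow, map_sub, map_one, PowerSeries.map_X]
  rw [add_smul, map_add, proj_one_add_CX_pow_smul, mul_comm, mul_smul,
    I.proj_smul_eq_zero n k _ _ (I.proj_one_add_CX_pow_sub_one_smul hi n k x), add_zero]

/-- **`groupEltO S x₁ x₂ = (1+T₁)^{x₁}(1+T₂)^{x₂}` acts on the level `(n,k)` of every pinned `𝒪`-carrier `H^i` (`i ≤ 2`) as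
`conj_{γ₁}^{x₁ mod pⁿ} ∘ conj_{γ₂}^{x₂ mod pⁿ}`.** [cite: JohnsonLeungKings2011, §4.2 (arXiv p0012:L109–112), §5.1 (p0014:L12–20)] [cite: NeukirchSchmidtWingberg2008, (5.3.5)] -/
theorem proj_groupEltO_smul (hi : i ≤ 2) (x₁ x₂ : ℤ_[p]) (n k : ℕ) (x : I.H) :
    I.proj n k (groupEltO S x₁ x₂ • x) =
      (layerConjEndO S κ₁ κ₂ θ 𝔣 n k i γ₁ ^ (PadicInt.toZModPow n x₁).val)
        ((layerConjEndO S κ₁ κ₂ θ 𝔣 n k i γ₂ ^ (PadicInt.toZModPow n x₂).val) (I.proj n k x)) := by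
  rw [groupEltO, groupElt, map_mul, mul_smul, I.proj_map_binomialSeries_smul hi, I.proj_C_binomialSeries_smul hi]

/-- **`groupEltO S x₁ x₂` acts on the level `(n,k)` as conjugation by ANY `g ∈ Γ_K` with
`γ₁^{x₁ mod pⁿ} γ₂^{x₂ mod pⁿ} g⁻¹ ∈ Gal(K̄/K̃_n)`** (`i ≤ 2`; the shape of the (A1) pin `artin_spec`).
[cite: JohnsonLeungKings2011, §5.1 (arXiv p0014:L12–20)] [cite: SerreLocalFields1979, VII §5 Prop. 3] -/
theorem proj_groupEltO_smul_eq_layerConjO (hi : i ≤ 2) {x₁ x₂ : ℤ_[p]} {n : ℕ} {g : absoluteGaloisGroup K}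
    (hg : γ₁ ^ (PadicInt.toZModPow n x₁).val * γ₂ ^ (PadicInt.toZModPow n x₂).val * g⁻¹ ∈
      pairLayerSubgroup κ₁ κ₂ n) (k : ℕ) (x : I.H) :
    I.proj n k (groupEltO S x₁ x₂ • x) = layerConjO S κ₁ κ₂ θ 𝔣 n k i g (I.proj n k x) := by
  rw [I.proj_groupEltO_smul hi, layerConjEndO, layerConjEndO, conjEndO_pow_apply, conjEndO_pow_apply,
    levelConjO_levelConjO, ← inv_mul_cancel_right (γ₁ ^ _ * γ₂ ^ _) g, ← levelConjO_levelConjO,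
    levelConjO_eq_self_of_mem S (suppPF p 𝔣) θ hg (isOpen_pairLayerSubgroup κ₁ κ₂ n) k hi]
  rfl

/-- **`nsubEltO 𝔞 = N𝔞 − χ(σ_𝔞)⁻¹(1+T₁)^{x₁}(1+T₂)^{x₂}` acts on the level `(n,k)` as `N𝔞 − χ(σ_𝔞)⁻¹ · conj_g`** for any `g`
as in `proj_groupEltO_smul_eq_layerConjO` (`i ≤ 2`), the scalar `χ(σ_𝔞)⁻¹ ∈ 𝒪` acting through `H^i(c ⊗ id)` ((P7)).
[cite: JohnsonLeungKings2011, §5.1 (arXiv p0014:L18–26), §3.3 (5) (p0010:L61–70)] -/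
theorem proj_nsubEltO_smul (hi : i ≤ 2) (a : AuxIdeals p 𝔣) {x₁ x₂ : ℤ_[p]} {n : ℕ} {g : absoluteGaloisGroup K}
    (hg : γ₁ ^ (PadicInt.toZModPow n x₁).val * γ₂ ^ (PadicInt.toZModPow n x₂).val * g⁻¹ ∈
      pairLayerSubgroup κ₁ κ₂ n) (k : ℕ) (x : I.H) :
    I.proj n k (nsubEltO S θ 𝔣 a x₁ x₂ • x) =
      ((Ideal.absNorm a.1 : ℕ) : ℤ) • I.proj n k x -
        layerScalarO S κ₁ κ₂ θ 𝔣 n k i (((thetaArtinO S θ 𝔣 a)⁻¹ : (padicCoeffIntegers S)ˣ) : padicCoeffIntegers S)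
          (layerConjO S κ₁ κ₂ θ 𝔣 n k i g (I.proj n k x)) := by
  rw [nsubEltO, sub_smul, map_sub, Nat.cast_smul_eq_nsmul, map_nsmul, ← natCast_zsmul, mul_smul,
    I.proj_C_smul, I.proj_groupEltO_smul_eq_layerConjO hi hg]

end IwasawaCohomologyDataO

/-- **For a `TwistedIwasawaDataO`, `artin 𝔞 = (𝔞, K_∞/K) ∈ Λ_𝒪` acts on the level `(n,k)` of `H¹` as conjugation by
Kato's lifted Artin symbol `(𝔞, K(p^s𝔣)/K) ∈ Γ_K` for every large `s` with `K̃_n ⊆ K(p^s𝔣)`** ((A1) + `proj_groupEltO_smul_eq_layerConjO`).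
[cite: JohnsonLeungKings2011, §5.1 (arXiv p0014:L12–20)] [cite: Kato2004Asterisque, §15.1 (p. 250)] -/
theorem TwistedIwasawaDataO.exists_proj_artin_smul {ι : K →+* ℂ} (D : TwistedIwasawaDataO S κ₁ κ₂ γ₁ γ₂ θ 𝔣 ι)
    (a : AuxIdeals p 𝔣) (n : ℕ) : ∃ s₀ : ℕ, ∀ s : ℕ, s₀ ≤ s →
      katoLevelSubgroup p 𝔣 s ≤ pairLayerSubgroup κ₁ κ₂ n → ∀ (k : ℕ) (x : D.D1.H),
        D.D1.proj n k (D.artin a • x) = layerConjO S κ₁ κ₂ θ 𝔣 n k 1 (layerArtin p 𝔣 s a.1) (D.D1.proj n k x) := by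
  obtain ⟨s₀, hs₀⟩ := D.artin_spec a n
  exact ⟨s₀, fun s hs hle k x ↦ D.D1.proj_groupEltO_smul_eq_layerConjO (by omega) (hs₀ s hs hle) k x⟩

/-- **For a `TwistedIwasawaDataO`, `nsub 𝔞 = N𝔞 − χ(σ_𝔞)⁻¹σ_𝔞` acts on the level `(n,k)` of `H¹` as
`N𝔞 − χ(σ_𝔞)⁻¹ · conj_{(𝔞, K(p^s𝔣)/K)}`** for every large `s` with `K̃_n ⊆ K(p^s𝔣)` — the levelwise form in which the
(Z2) pin is an identity of `t_p(χ) ⊗` twisted Kummer classes. [cite: JohnsonLeungKings2011, §5.1 (arXiv p0014:L18–26), Prop. 3.3 (3) (p0009:L88–95)] -/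
theorem TwistedIwasawaDataO.exists_proj_nsub_smul {ι : K →+* ℂ} (D : TwistedIwasawaDataO S κ₁ κ₂ γ₁ γ₂ θ 𝔣 ι)
    (a : AuxIdeals p 𝔣) (n : ℕ) : ∃ s₀ : ℕ, ∀ s : ℕ, s₀ ≤ s →
      katoLevelSubgroup p 𝔣 s ≤ pairLayerSubgroup κ₁ κ₂ n → ∀ (k : ℕ) (x : D.D1.H),
        D.D1.proj n k (D.nsub a • x) =
          ((Ideal.absNorm a.1 : ℕ) : ℤ) • D.D1.proj n k x -
            layerScalarO S κ₁ κ₂ θ 𝔣 n k 1 (((thetaArtinO S θ 𝔣 a)⁻¹ : (padicCoeffIntegers S)ˣ) : padicCoeffIntegers S)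
              (layerConjO S κ₁ κ₂ θ 𝔣 n k 1 (layerArtin p 𝔣 s a.1) (D.D1.proj n k x)) := by
  obtain ⟨s₀, hs₀⟩ := D.artin_spec a n
  exact ⟨s₀, fun s hs hle k x ↦ D.D1.proj_nsubEltO_smul (by omega) a (hs₀ s hs hle) k x⟩

end Datum

end Literature.NumberTheory.ComplexMultiplication.EllipticUnits.JohnsonLeungKings2011

end
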